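import Mathlib.NumberTheory.Transcendental.Liouville.LiouvilleWith
import Literature.NumberTheory.Transcendental.PeriodsWave0
import HarnessLib

/-!
# The record irrationality measure of `ζ(3)` (Rhin–Viola 2001)

Topic `Literature/NumberTheory/Irrationality/RhinViola2001`. Typed, cited statement (no proof) of the main
result of G. Rhin, C. Viola, *The group structure for ζ(3)*, Acta Arith. **97** (2001) 269–293
[RhinViola2001]: the irrationality exponent of `ζ(3)` satisfies `μ(ζ(3)) < 5.513891`. PRIMARY SOURCE now
read on the page (Acta Arith. open access, materialised by the cell pub-zeta5 lit seat, 2026-08-19): §1 display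
(1.4) "`μ(ζ(3)) < 5.513891`", where "we denote here by `μ(α)` the least irrationality measure of an irrational
number `α`, i.e., the least exponent `λ` such that for any `ε > 0` there exists a constant `q₀ = q₀(ε) > 0` for
which `|α − p/q| > q^{−λ−ε}` for all integers `p` and `q` with `q > q₀`" (p. 269); proved in §5 as
**Theorem 5.1**: "If `c₀ > c₂`, then `μ(ζ(3)) ≤ (c₀ + c₁)/(c₀ − c₂)`", applied with the parameters
`h = 16, j = 17, k = 19, l = 15, m = 12, q = 11, r = 9, s = 13` (`h+m = k+r`, `j+q = l+s`), for which
`c₀ = 47.15472079…`, `c₁ = 48.46940964…`, `c₂ = 29.81231469…`: "Thus Theorem 5.1 yields `μ(ζ(3)) < 5.513891`"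
(p. 293, last display; `(c₀+c₁)/(c₀−c₂) = 5.5138909…`); "the irrationality measure (1.4) of `ζ(3)` proved in
the present paper … is effective" (p. 270). Previous records quoted there: Apéry `13.41782…`, Hata `7.377956…`.
Secondary restatement (the source this file was first typed from): S. Dauguet, W. Zudilin, J. Number Theory
**145** (2014) 362–387 = arXiv:1401.5322 [DauguetZudilin2014], §1 p. 3.

Rendering (as in `Zudilin2014/ZetaTwoMeasure.lean`): `μ(x) < c` implies `¬ LiouvilleWith p x` for every
`p ≥ c`; `ζ(3) = zetaValue 3` of `PeriodsWave0.lean` (irrational by the tree's Apéry theorem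
`irrational_zetaValue_three`, which this file does not use).

Cell pub-zeta5 (HONEST FRAMING: systematic search; no irrationality claim unless certified): a RECORD entry
(LITERATURE.md §C, FRESHNESS §1.1); the comparison scale for the cell's criterion C4 (effective measures from
certificates, `Summits/…/Zeta5Search/Measure.lean`).
-/

noncomputable section

namespace Literature.NumberTheory.Irrationality.RhinViola2001

open Literature.NumberTheory.Transcendental (zetaValue)

/-- **Rhin–Viola 2001** (named fact, statement only): `μ(ζ(3)) < 5.513891`; rendered as: for every exponent
`p ≥ 5.513891`, `ζ(3)` is not `p`-Liouville (`¬ LiouvilleWith p (zetaValue 3)`).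
[cite: RhinViola2001, §1 (1.4) and §5 Theorem 5.1 with the final display p. 293 (μ(ζ(3)) < 5.513891)] [cite: DauguetZudilin2014, §1 p. 3 (restatement)] -/
def zetaThree_irrationalityExponent_lt : Prop :=
  ∀ p : ℝ, (5.513891 : ℝ) ≤ p → ¬ LiouvilleWith p (zetaValue 3)

end Literature.NumberTheory.Irrationality.RhinViola2001
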